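import Summits.KontsevichZagierPeriods.KontsevichZagierPeriods.Theorems.LinRedNormalFormArrangementNormalFormStubRebaseSimplePosOnePosQuadCuts
import Summits.KontsevichZagierPeriods.KontsevichZagierPeriods.Theorems.LinRedNormalFormArrangementNormalFormStubRebaseSimplePosOnePosQuadChoice
import Summits.KontsevichZagierPeriods.KontsevichZagierPeriods.Theorems.LinRedNormalFormArrangementNormalFormStubRebaseSimplePosOnePosParThinQuadCell

/-!
# Stub `stub_rebaseSimplePosOnePos` (crux `ArrangementNormalForm`, line `janus-bands`) —
part `QuadFinal`: a flat cell with a quadruple point is good (`B = 2`)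

`B = 2` corner calculus: the assembly. `RebasePos.good_quadCell_two` discharges the `Q`-branch
of hypothesis `HUQ` of part `ParThinQuadCell` over the base `(x₁, x₂, y)`: for the data of `Hpar`
over a product cell whose closed cell contains a quadruple point (`ylo = yhi`, `u = v`,
`u₀ + s ℓ₂ = 0`, `ylo = ℓ₂`),
* dependent height and width → `RebasePos.good_parCell_of_flat_dep` (part `ParFlatDep`);
* otherwise the flat point `X` is unique and rational (part `QuadLocal`); choose a generic
  direction `q` (`exists_generic_q`) and a small radius `r` (`exists_small`, part `QuadChoice`);
  localise (`good_quadCell_of_inner`), move to the first frame and separate the far factors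
  (`good_inner_of_term`, part `QuadFrame1`), and close every terminal datum by
  `good_frame1_term` (part `QuadCuts`: shear, cuts into eight sector pieces, blow-up of the
  steep piece, parts `QuadPieces`, `QuadSector`, `QuadMove`, `QuadClose`).
Registered as `rebaseSimplePos_quadCellTwo`.

References: M. Kontsevich, D. Zagier, *Periods* (2001), §1.2, rules (1a), (1b), (2).
-/

noncomputable section

open Set MeasureTheory MvPolynomial
open Literature.NumberTheory.Transcendental Literature.ModelTheory.ExponentialFields

namespace Summit.KontsevichZagierPeriods.ArrangementNormalForm.JanusBands

namespace RebasePos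

open SeparatePos

section Final

variable {m m' m₀ : ℕ} (L : Fin m → (Fin 2 → ℚ) × ℚ) (e : Fin m → ℕ) (ℓ₁ ℓ₂ : (Fin 2 → ℚ) × ℚ)

/-- The constant of a full-base form in the first frame is the value of its `κ'`-form at `X`. -/
theorem normFQ_snd (X : Fin 2 → ℚ) (A : Matrix (Fin 2) (Fin 2) ℚ) (c : (Fin (2 + 1) → ℚ) × ℚ) :
    (normFQ X A 1 ℓ₂ c).2 = (restr 2 c - (-c.1 (Fin.last 2)) • ℓ₂).1 0 * X 0 +
      (restr 2 c - (-c.1 (Fin.last 2)) • ℓ₂).1 1 * X 1 + (restr 2 c - (-c.1 (Fin.last 2)) • ℓ₂).2 := by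
  simp only [normFQ, restr, Prod.fst_sub, Prod.snd_sub, Pi.sub_apply, Prod.smul_fst, Prod.smul_snd, Pi.smul_apply,
    smul_eq_mul, show (Fin.last 2 : Fin (2 + 1)) = 2 from rfl, show (Fin.castSucc (0 : Fin 2) : Fin (2 + 1)) = 0 from rfl,
    show (Fin.castSucc (1 : Fin 2) : Fin (2 + 1)) = 1 from rfl]
  ring

/-- Inside the four box rows. -/
theorem box_of_rows (M₀ : Fin m₀ → (Fin 2 → ℚ) × ℚ) (X : Fin 2 → ℚ) (r : ℚ) (z : Fin (2 + 1 + 1) → ℝ)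
    (hz : ∀ j, 0 < affB 2 1 ((Fin.snoc (Fin.snoc (Fin.snoc (Fin.snoc M₀ (boxAtQ X r 0)) (boxAtQ X r 1)) (boxAtQ X r 2))
      (boxAtQ X r 3) : Fin (m₀ + 1 + 1 + 1 + 1) → _) j) z) :
    |z 0 - X 0| < r ∧ |z 1 - X 1| < r := by
  rw [rowsB_snoc_iff, rowsB_snoc_iff, rowsB_snoc_iff, rowsB_snoc_iff] at hz
  obtain ⟨⟨⟨⟨-, h0⟩, h1⟩, h2⟩, h3⟩ := hz
  simp only [boxAtQ, affB_three, Matrix.cons_val_zero, Matrix.cons_val_one, Matrix.cons_val] at h0 h1 h2 h3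
  push_cast at h0 h1 h2 h3
  constructor <;> rw [abs_lt] <;> constructor <;> linarith

/-- The `x'`-rows of the inner piece are non-negative at the flat point. -/
theorem rows_box_nonneg (M₀ : Fin m₀ → (Fin 2 → ℚ) × ℚ) (X : Fin 2 → ℚ) (r : ℚ) (hr : 0 < r)
    (hM₀X : ∀ j, 0 ≤ (M₀ j).1 0 * X 0 + (M₀ j).1 1 * X 1 + (M₀ j).2) :
    ∀ j, 0 ≤ ((Fin.snoc (Fin.snoc (Fin.snoc (Fin.snoc M₀ (boxAtQ X r 0)) (boxAtQ X r 1)) (boxAtQ X r 2)) (boxAtQ X r 3) :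
        Fin (m₀ + 1 + 1 + 1 + 1) → (Fin 2 → ℚ) × ℚ) j).1 0 * X 0 +
      ((Fin.snoc (Fin.snoc (Fin.snoc (Fin.snoc M₀ (boxAtQ X r 0)) (boxAtQ X r 1)) (boxAtQ X r 2)) (boxAtQ X r 3) :
        Fin (m₀ + 1 + 1 + 1 + 1) → (Fin 2 → ℚ) × ℚ) j).1 1 * X 1 +
      ((Fin.snoc (Fin.snoc (Fin.snoc (Fin.snoc M₀ (boxAtQ X r 0)) (boxAtQ X r 1)) (boxAtQ X r 2)) (boxAtQ X r 3) :
        Fin (m₀ + 1 + 1 + 1 + 1) → (Fin 2 → ℚ) × ℚ) j).2 := by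
  intro j
  refine Fin.lastCases ?_ (fun j => ?_) j
  · simp [boxAtQ]; linarith
  simp only [Fin.snoc_castSucc]
  refine Fin.lastCases ?_ (fun j => ?_) j
  · simp [boxAtQ]; linarith
  simp only [Fin.snoc_castSucc]
  refine Fin.lastCases ?_ (fun j => ?_) j
  · simp [boxAtQ]; linarith
  simp only [Fin.snoc_castSucc]
  refine Fin.lastCases ?_ (fun j => ?_) j
  · simp [boxAtQ]
    linarith
  simp only [Fin.snoc_castSucc]
  exact hM₀X j

/-- **A flat cell with a quadruple point is good** (`B = 2`). See the module docstring. -/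
theorem good_quadCell_two (s : KZ.IntegralRep (2 + 1 + 1)) (M : Fin m' → (Fin (2 + 1) → ℚ) × ℚ)
    (M₀ : Fin m₀ → (Fin 2 → ℚ) × ℚ) (ylo yhi : (Fin 2 → ℚ) × ℚ) (p : MvPolynomial (Fin 2) ℚ)
    (u v : (Fin (2 + 1) → ℚ) × ℚ) (hbd : Bornology.IsBounded s.domain)
    (hdom : s.domain = gDom 2 1 m' M (fun _ => Sum.inr u) (fun _ => Sum.inr v))
    (hint : EqOn s.integrand (glit 2 1 p L e ℓ₁ ℓ₂ 0 1 (fun _ => some 0)) s.domain)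
    (hu : u.1 (Fin.last 2) ≠ 0) (hpar : u.1 (Fin.last 2) = v.1 (Fin.last 2))
    (hcell : ∀ z : Fin (2 + 1 + 1) → ℝ, (∀ j, 0 < affF 2 1 (M j) z) → 0 < affF 2 1 u z ∧ affF 2 1 u z < affF 2 1 v z)
    (hsec : ∀ z : Fin (2 + 1 + 1) → ℝ, (∀ j, 0 < affF 2 1 (M j) z) ↔ ((∀ j, 0 < affB 2 1 (M₀ j) z) ∧
      affB 2 1 ylo z < z (Fin.castAdd 1 (Fin.last 2)) ∧ z (Fin.castAdd 1 (Fin.last 2)) < affB 2 1 yhi z))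
    (hquad : ∃ z ∈ closure {z : Fin (2 + 1 + 1) → ℝ | ∀ j, 0 < affF 2 1 (M j) z},
      affB 2 1 ylo z = affB 2 1 yhi z ∧ affF 2 1 u z = affF 2 1 v z ∧
        affB 2 1 (restr 2 u) z + (u.1 (Fin.last 2) : ℝ) * affB 2 1 ℓ₂ z = 0 ∧ affB 2 1 ylo z = affB 2 1 ℓ₂ z) :
    ∃ c ∈ AddSubgroup.closure (GGset 2 2 1), KZ.of s - c ∈ KZ.relations := by
  classical
  -- dependent height and width
  by_cases hdep : ∃ c : ℚ, (yhi - ylo).1 = c • (restr 2 v - restr 2 u).1 ∨ (restr 2 v - restr 2 u).1 = c • (yhi - ylo).1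
  · obtain ⟨z, hz, h1, h2, -, -⟩ := hquad
    exact good_parCell_of_flat_dep L e ℓ₁ ℓ₂ s M M₀ ylo yhi p u v hbd hdom hint hpar hcell hsec ⟨z, hz, h1, h2⟩ hdep
  have hh : (yhi - ylo).1 ≠ 0 := fun h => hdep ⟨0, Or.inl (by rw [h, zero_smul])⟩
  have hdet : detQ (yhi - ylo) (restr 2 v - restr 2 u) ≠ 0 :=
    detQ_ne_zero_of_indep _ _ hh fun ⟨c, hc⟩ => hdep ⟨c, Or.inr hc⟩
  -- the flat point and the quadruple point
  set X : Fin 2 → ℚ := flatPtQ (yhi - ylo) (restr 2 v - restr 2 u) with hX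
  have hXall := quad_at_flatPt ℓ₂ M ylo yhi u v hpar hdet hquad
  have hXh := hXall (yhi - ylo) (Or.inl rfl)
  have hXw := hXall (restr 2 v - restr 2 u) (Or.inr (Or.inl rfl))
  have hXk := hXall _ (Or.inr (Or.inr (Or.inl rfl)))
  have hXa := hXall (ylo - ℓ₂) (Or.inr (Or.inr (Or.inr rfl)))
  -- the `x'`-rows are non-negative at the flat point
  have hM₀X : ∀ j, 0 ≤ (M₀ j).1 0 * X 0 + (M₀ j).1 1 * X 1 + (M₀ j).2 := by
    intro j
    obtain ⟨z, hz, h1, h2, -, -⟩ := hquad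
    have hzX := flatPtQ_spec _ _ hdet z (by rw [affB_sub, h1, sub_self])
      (by rw [affB_sub, ← width_eq u v hpar, h2, sub_self])
    have hle : 0 ≤ affB 2 1 (M₀ j) z :=
      le_of_closure_rows continuous_const (continuous_affB_one _) (fun w hw => (((hsec w).1 hw).1 j).le) z hz
    rw [affB_three, hzX.1, hzX.2] at hle
    exact_mod_cast hle
  -- the generic direction and the small radius
  obtain ⟨q, hq⟩ := exists_generic_q X L
  set lam := sepLamQ (NLQ X q L) with hlam
  obtain ⟨r, hr, hrK⟩ := exists_small (ι := Fin m ⊕ (Fin m × Fin m))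
    (Sum.elim (fun j => |(L j).1 0| + |(L j).1 1|) (fun jj => (1 + |q|) * |(lam jj.1).1 0 - (lam jj.2).1 0|))
    (Sum.elim (fun j => if (NLQ X q L j).2 = 0 then 1 else |(NLQ X q L j).2|)
      (fun jj => if (lam jj.1).2 = (lam jj.2).2 then 1 else |(lam jj.1).2 - (lam jj.2).2|))
    (fun i => by rcases i with j | jj <;> simp only [Sum.elim_inl, Sum.elim_inr] <;> positivity)
    (fun i => by
      rcases i with j | jj <;> simp only [Sum.elim_inl, Sum.elim_inr] <;> split_ifs with h
      · exact one_pos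
      · exact abs_pos.mpr h
      · exact one_pos
      · exact abs_pos.mpr (sub_ne_zero.mpr h))
  -- localise, move to the first frame, separate
  refine good_quadCell_of_inner L e ℓ₁ ℓ₂ s M M₀ ylo yhi p u v hbd hdom hint hu hpar hcell hsec hdet r hr
    fun t hts hti htd htsec => ?_
  have htcell : ∀ z : Fin (2 + 1 + 1) → ℝ, (∀ j, 0 < affF 2 1 ((Fin.snoc (Fin.snoc (Fin.snoc (Fin.snoc M
      (liftX (boxAtQ X r 0))) (liftX (boxAtQ X r 1))) (liftX (boxAtQ X r 2))) (liftX (boxAtQ X r 3)) :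
        Fin (m' + 1 + 1 + 1 + 1) → _) j) z) → 0 < affF 2 1 u z ∧ affF 2 1 u z < affF 2 1 v z :=
    fun z hz => hcell z (rows_snoc (rows_snoc (rows_snoc (rows_snoc hz).1).1).1).1
  refine good_inner_of_term L e ℓ₁ ℓ₂ t _ _ ylo yhi p u v X q r hr (hbd.subset hts) htd (by rw [hti]; exact hint.mono hts)
    htsec (fun z hz => box_of_rows M₀ X r z hz) (fun j hej hγ z h0 h1 hz0 => ?_) (fun j j' _ _ hβ hγ hβ' hγ' hne => ?_)
    (fun n L' e' d' s'' hbd'' hdom'' hint'' hPL hall => ?_)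
  · -- the far factors do not vanish on the box
    have hK := hrK (Sum.inl j)
    simp only [Sum.elim_inl, if_neg hγ] at hK
    rw [NLQ_eq] at hK hγ
    change (|(L j).1 0| + |(L j).1 1|) * r < |(L j).1 0 * X 0 + (L j).1 1 * X 1 + (L j).2| at hK
    change (L j).1 0 * X 0 + (L j).1 1 * X 1 + (L j).2 ≠ 0 at hγ
    have hK' := (Rat.cast_lt (K := ℝ)).mpr hK
    push_cast at hK'
    rw [affB_three] at hz0
    have hdev : |((L j).1 0 : ℝ) * (z 0 - X 0) + ((L j).1 1 : ℝ) * (z 1 - X 1)| ≤ (|((L j).1 0 : ℝ)| + |((L j).1 1 : ℝ)|) * r := by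
      refine (abs_add_le _ _).trans ?_
      rw [abs_mul, abs_mul, add_mul]
      exact add_le_add (mul_le_mul_of_nonneg_left h0.le (abs_nonneg _)) (mul_le_mul_of_nonneg_left h1.le (abs_nonneg _))
    have hsum : ((L j).1 0 : ℝ) * X 0 + ((L j).1 1 : ℝ) * X 1 + ((L j).2 : ℝ) =
        -(((L j).1 0 : ℝ) * (z 0 - X 0) + ((L j).1 1 : ℝ) * (z 1 - X 1)) := by linarith
    rw [hsum, abs_neg] at hK'
    linarith
  · -- the resultant bound
    have hne2 : (lam j).2 ≠ (lam j').2 := hq j j' hγ hγ' hβ hβ' hne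
    have hK := hrK (Sum.inr (j, j'))
    simp only [Sum.elim_inr, if_neg hne2] at hK
    have hK' := (Rat.cast_lt (K := ℝ)).mpr hK
    push_cast at hK'
    have hr0 : (0 : ℝ) ≤ r := by exact_mod_cast hr.le
    refine ⟨|((lam j).2 : ℝ) - (lam j').2| - (1 + |(q : ℝ)|) * r * |((lam j).1 0 : ℝ) - (lam j').1 0|, by nlinarith,
      fun x hx => ?_⟩
    have h1 : |(((lam j).1 0 : ℝ) - (lam j').1 0) * x| ≤ (1 + |(q : ℝ)|) * r * |((lam j).1 0 : ℝ) - (lam j').1 0| := by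
      rw [abs_mul]; nlinarith [abs_nonneg (((lam j).1 0 : ℝ) - (lam j').1 0), abs_nonneg x, hx]
    have h2 : |((lam j).2 : ℝ) - (lam j').2| ≤ |(((lam j).1 0 : ℝ) - (lam j').1 0) * x + (((lam j).2 : ℝ) - (lam j').2)| +
        |(((lam j).1 0 : ℝ) - (lam j').1 0) * x| := by
      have := abs_add_le ((((lam j).1 0 : ℝ) - (lam j').1 0) * x + (((lam j).2 : ℝ) - (lam j').2))
        (-((((lam j).1 0 : ℝ) - (lam j').1 0) * x))
      rwa [abs_neg, show (((lam j).1 0 : ℝ) - (lam j').1 0) * x + (((lam j).2 : ℝ) - (lam j').2) +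
        -((((lam j).1 0 : ℝ) - (lam j').1 0) * x) = ((lam j).2 : ℝ) - (lam j').2 by ring] at this
    rw [← hlam]
    linarith
  · -- the terminal data: the adapter to `good_frame1_term`
    set A := matQ q with hA
    set NL := NLQ X q L with hNL
    set Rx₀ : Fin (m₀ + 1 + 1 + 1 + 1) → (Fin 2 → ℚ) × ℚ :=
      Fin.snoc (Fin.snoc (Fin.snoc (Fin.snoc M₀ (boxAtQ X r 0)) (boxAtQ X r 1)) (boxAtQ X r 2)) (boxAtQ X r 3) with hRx₀
    -- the `y`-free rows in the first frame, split into linear and far rows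
    set Rx : Fin (m₀ + 1 + 1 + 1 + 1) → (Fin (2 + 1) → ℚ) × ℚ := fun j => liftX (normLQ X A (Rx₀ j)) with hRx
    have hRx_nn : ∀ j, (Rx j).1 2 = 0 ∧ 0 ≤ (Rx j).2 := fun j =>
      ⟨liftX_last _, by simpa [hRx, liftX, normLQ] using rows_box_nonneg M₀ X r hr hM₀X j⟩
    obtain ⟨k₁, k₂, Rlin, Rfar, hp₁, hp₂, hsplit⟩ := split_family (fun c : (Fin (2 + 1) → ℚ) × ℚ => c.2 = 0) Rx
    have hnn := (hsplit (fun c => c.1 2 = 0 ∧ 0 ≤ c.2)).1 hRx_nn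
    have hlin' : ∀ i, (Rlin i).2 = 0 ∧ (Rlin i).1 2 = 0 := fun i => ⟨hp₁ i, (hnn.1 i).1⟩
    have hfar' : ∀ i, (Rfar i).1 2 = 0 ∧ 0 < (Rfar i).2 := fun i =>
      ⟨(hnn.2 i).1, lt_of_le_of_ne (hnn.2 i).2 (Ne.symm (hp₂ i))⟩
    -- walls and bounds in the first frame
    set a := normLQ X A (ylo - ℓ₂) with ha
    set b := normLQ X A (yhi - ℓ₂) with hb
    set U := normFQ X A 1 ℓ₂ u with hU
    set V := normFQ X A 1 ℓ₂ v with hV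
    have hab : a.2 = 0 ∧ b.2 = 0 := by
      refine ⟨hXa, ?_⟩
      have hsplit₂ : yhi - ℓ₂ = (yhi - ylo) + (ylo - ℓ₂) := by abel
      show (yhi - ℓ₂).1 0 * X 0 + (yhi - ℓ₂).1 1 * X 1 + (yhi - ℓ₂).2 = 0
      rw [hsplit₂]
      simp only [Prod.fst_add, Prod.snd_add, Pi.add_apply]
      linarith [hXh, hXa]
    have hUV : U.1 2 ≠ 0 ∧ U.1 2 = V.1 2 ∧ U.2 = 0 ∧ V.2 = 0 := by
      refine ⟨?_, ?_, ?_, ?_⟩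
      · simpa [hU, normFQ] using hu
      · simp only [hU, hV, normFQ, Matrix.cons_val, mul_one]; exact hpar
      · rw [hU, normFQ_snd]; exact hXk
      · rw [hV, normFQ_snd]
        have hsplit₃ : restr 2 v - (-v.1 (Fin.last 2)) • ℓ₂ = (restr 2 u - (-u.1 (Fin.last 2)) • ℓ₂) + (restr 2 v - restr 2 u) := by
          rw [← hpar]; abel
        rw [hsplit₃]
        simp only [Prod.fst_add, Prod.snd_add, Pi.add_apply]
        linarith [hXk, hXw]
    -- the rows of the terminal datum
    have hy : ∀ w : Fin (2 + 1 + 1) → ℝ, normMapQ X A 1 ℓ₂ w 2 = affB 2 1 ℓ₂ (normMapQ X A 1 ℓ₂ w) + w 2 := fun w => by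
      rw [normMapQ_two, affB_three, normMapQ_zero, normMapQ_one]; push_cast; ring
    have hrows : ∀ w : Fin (2 + 1 + 1) → ℝ, (∀ j, 0 < affB 2 1 (Rx₀ j) (normMapQ X A 1 ℓ₂ w)) ↔
        ((∀ i, 0 < affF 2 1 (Rlin i) w) ∧ ∀ i, 0 < affF 2 1 (Rfar i) w) := fun w => by
      rw [← hsplit (fun c => 0 < affF 2 1 c w)]
      refine forall_congr' fun j => ?_
      rw [hRx]
      dsimp only
      rw [affF_liftX, affB_normLQ X A 1 ℓ₂]
    have hR : ∀ w : Fin (2 + 1 + 1) → ℝ, (∀ j, 0 < affF 2 1 (normFQ X A 1 ℓ₂ (canonRowsQ Rx₀ ylo yhi j)) w) ↔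
        ((∀ i, 0 < affF 2 1 (Rlin i) w) ∧ (∀ i, 0 < affF 2 1 (Rfar i) w) ∧ affB 2 1 a w < w 2 ∧ w 2 < affB 2 1 b w) := by
      intro w
      simp only [affF_normFQ]
      rw [canonRowsQ_iff, jy_eq, hrows, hy, ha, hb, affB_normLQ X A 1 ℓ₂, affB_normLQ X A 1 ℓ₂, affB_sub, affB_sub]
      constructor
      · rintro ⟨⟨h1, h2⟩, h3, h4⟩; exact ⟨h1, h2, by linarith, by linarith⟩
      · rintro ⟨h1, h2, h3, h4⟩; exact ⟨⟨h1, h2⟩, by linarith, by linarith⟩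
    have hcell'' : ∀ w : Fin (2 + 1 + 1) → ℝ, (∀ j, 0 < affF 2 1 (normFQ X A 1 ℓ₂ (canonRowsQ Rx₀ ylo yhi j)) w) →
        0 < affF 2 1 U w ∧ affF 2 1 U w < affF 2 1 V w := by
      intro w hw
      have hz : ∀ j, 0 < affF 2 1 (canonRowsQ Rx₀ ylo yhi j) (normMapQ X A 1 ℓ₂ w) := fun j => by
        rw [← affF_normFQ X A 1 ℓ₂]; exact hw j
      rw [canonRowsQ_iff] at hz
      have h := htcell _ ((htsec _).2 hz)
      rwa [← affF_normFQ X A 1 ℓ₂, ← affF_normFQ X A 1 ℓ₂] at h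
    have huniq'' : ∀ w : Fin (2 + 1 + 1) → ℝ, affB 2 1 a w = affB 2 1 b w → affF 2 1 U w = affF 2 1 V w →
        w 0 = 0 ∧ w 1 = 0 := by
      intro w h1 h2
      rw [ha, hb, affB_normLQ X A 1 ℓ₂, affB_normLQ X A 1 ℓ₂, affB_sub, affB_sub] at h1
      rw [hU, hV, affF_normFQ, affF_normFQ] at h2
      have hzX := flatPtQ_spec _ _ hdet (normMapQ X A 1 ℓ₂ w) (by rw [affB_sub]; linarith)
        (by rw [affB_sub, ← width_eq u v hpar, h2, sub_self])
      have key := normInvQ_normMapQ X A (matInvQ q) 1 ℓ₂ (matInvQ_mul q) (by norm_num) w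
      have e0 := congrFun key 0
      have e1 := congrFun key 1
      rw [← hX] at hzX
      simp only [normInvQ, hzX.1, hzX.2, sub_self, mul_zero, add_zero, Matrix.cons_val_zero, Matrix.cons_val_one] at e0 e1
      exact ⟨e0.symm, e1.symm⟩
    -- the far factors of the terminal datum
    have hright : ∀ j, (lineOfLamQ (lam j)).2 ≠ 0 → ((NL j).1 1 ≠ 0 ∧ (NL j).2 ≠ 0) := by
      intro j h2
      rw [lineOfLamQ, hlam, sepLamQ] at h2
      simp only [neg_ne_zero, div_ne_zero_iff] at h2
      exact ⟨h2.2, h2.1⟩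
    have hLt_gen : ∃ G₀ Gc : ℚ, ∀ i, termEsQ L' e' d' i ≠ 0 → (termLsQ L' NL i).2 ≠ 0 →
        (termLsQ L' NL i).1 1 = 0 ∨ termLsQ L' NL i = (![G₀, 1], Gc) := by
      by_cases hex : ∃ j, ((NL j).1 1 ≠ 0 ∧ (NL j).2 ≠ 0) ∧ d' j ≠ 0
      · obtain ⟨j₀, hS₀, hd₀⟩ := hex
        refine ⟨-(lam j₀).1 0, -(lam j₀).2, fun i hE h2 => ?_⟩
        induction i using Fin.addCases with
        | left i => left; simp [termLsQ, backLQ]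
        | right j =>
          simp only [termLsQ, termEsQ, Fin.append_right] at hE h2 ⊢
          right
          have heq := hall j j₀ (hright j h2) hS₀ hE hd₀
          change lam j = lam j₀ at heq
          rw [lineOfLamQ]
          change (![-(lam j).1 0, 1], -(lam j).2) = _
          rw [heq]
      · refine ⟨0, 0, fun i hE h2 => ?_⟩
        induction i using Fin.addCases with
        | left i => left; simp [termLsQ, backLQ]
        | right j =>
          simp only [termLsQ, termEsQ, Fin.append_right] at hE h2
          exact absurd ⟨j, hright j h2, hE⟩ hex
    obtain ⟨G₀, Gc, hLt⟩ := hLt_gen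
    exact good_frame1_term ℓ₁ (termLsQ L' NL) (termEsQ L' e' d') G₀ Gc s'' _ Rlin Rfar a b _ U V hbd'' hdom'' hint'' hR hlin'
      hfar' hab hLt hUV hcell'' huniq''

end Final

end RebasePos

/-- **Registered part of `stub_rebaseSimplePosOnePos` (line `janus-bands`, `B = 2` corner
calculus): a flat cell with a quadruple point is good** (`RebasePos.good_quadCell_two`). For the
data of `Hpar` over a product cell of the base `(x₁, x₂, y)` whose closed cell contains a
quadruple point (`ylo = yhi`, `u = v`, `u₀ + s ℓ₂ = 0`, `ylo = ℓ₂`), `[s]` lies in the subgroup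
generated by `GG 2 2 1` modulo `KZ.relations` — the `Q`-branch of hypothesis `HUQ` of
`rebaseSimplePosOnePos_of_thinQuad'` at `b = 0`. -/
theorem rebaseSimplePos_quadCellTwo (m m' m₀ : ℕ) (L : Fin m → (Fin 2 → ℚ) × ℚ) (e : Fin m → ℕ) (ℓ₁ ℓ₂ : (Fin 2 → ℚ) × ℚ) (s : KZ.IntegralRep (2 + 1 + 1)) (M : Fin m' → (Fin (2 + 1) → ℚ) × ℚ) (M₀ : Fin m₀ → (Fin 2 → ℚ) × ℚ) (ylo yhi : (Fin 2 → ℚ) × ℚ) (p : MvPolynomial (Fin 2) ℚ) (u v : (Fin (2 + 1) → ℚ) × ℚ) (hbd : Bornology.IsBounded s.domain) (hdom : s.domain = SeparatePos.gDom 2 1 m' M (fun _ => Sum.inr u) (fun _ => Sum.inr v)) (hint : Set.EqOn s.integrand (RebasePos.glit 2 1 p L e ℓ₁ ℓ₂ 0 1 (fun _ => some 0)) s.domain) (hu : u.1 (Fin.last 2) ≠ 0) (hpar : u.1 (Fin.last 2) = v.1 (Fin.last 2)) (hcell : ∀ z : Fin (2 + 1 + 1) → ℝ, (∀ j, 0 <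 SeparatePos.affF 2 1 (M j) z) → 0 < SeparatePos.affF 2 1 u z ∧ SeparatePos.affF 2 1 u z < SeparatePos.affF 2 1 v z) (hsec : ∀ z : Fin (2 + 1 + 1) → ℝ, (∀ j, 0 < SeparatePos.affF 2 1 (M j) z) ↔ ((∀ j, 0 < SeparatePos.affB 2 1 (M₀ j) z) ∧ SeparatePos.affB 2 1 ylo z < z (Fin.castAdd 1 (Fin.last 2)) ∧ z (Fin.castAdd 1 (Fin.last 2)) < SeparatePos.affB 2 1 yhi z)) (hquad : ∃ z ∈ closure {z : Fin (2 + 1 + 1) → ℝ | ∀ j, 0 < SeparatePos.affF 2 1 (M j) z}, SeparatePos.affB 2 1 ylo z = SeparatePos.affB 2 1 yhi z ∧ SeparatePos.affF 2 1 u z = SeparatePos.affF 2 1 v z ∧ SeparatePos.affB 2 1 (SeparatePos.restr 2 u) z + (u.1 (Fin.last 2) : ℝ) * SeparatePos.affB 2 1 ℓ₂ z = 0 ∧ SeparatePos.affB 2 1 ylo z = SeparatePos.affB 2 1 ℓ₂ z) : ∃ c ∈ AddSubgroup.closure (SeparatePos.GGset 2 2 1), KZ.of s - c ∈ KZ.relations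 :=
  RebasePos.good_quadCell_two L e ℓ₁ ℓ₂ s M M₀ ylo yhi p u v hbd hdom hint hu hpar hcell hsec hquad

/-- **Stub format, `b = 0`** (`stub_rebaseSimplePosOnePos` over the base `(x₁, x₂, y)`, line
`janus-bands`): the stub holds at `b = 0` as soon as, for some `ε > 0`, the `ε`-thin parallel
cells at pole distance `≥ δ` with a triple point `h = w = κ' = 0` (`HU`) and the double corners of
the non-parallel case (`Hdthick`, `Hdfar`) are good; the flat cells with a quadruple point are
discharged by `RebasePos.good_quadCell_two` (this file). -/
theorem rebaseSimplePosOnePos_two_of_U' (GS : ℕ → ℕ → Set KZ.FormalRep) (GG : ℕ → ℕ → ℕ → Set KZ.FormalRep) (hGS : ∀ b k, GS b k = {w : KZ.FormalRep | ∃ (m m' n₁ n₂ : ℕ) (s : KZ.IntegralRep (b + 1 + k)) (M : Fin m' → (Fin (b + 1) → ℚ) × ℚ) (L : Fin m → (Fin b → ℚ) × ℚ) (e : Fin m → ℕ) (p : MvPolynomial (Fin b) ℚ) (ℓ₁ ℓ₂ : (Fin b → ℚ) × ℚ) (a : Fin k → Option ((Fin (b + 1) → ℚ) × ℚ)) (lo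 hi : Fin k → Fin k ⊕ ((Fin (b + 1) → ℚ) × ℚ)), (n₁ = 0 ∨ n₂ = 0) ∧ n₂ = 1 ∧ Bornology.IsBounded s.domain ∧ s.domain = {z | (∀ j, 0 < ∑ i, ((M j).1 i : ℝ) * z (Fin.castAdd k i) + ((M j).2 : ℝ)) ∧ ∀ i, Sum.elim (fun j => z (Fin.natAdd (b + 1) j)) (fun c => ∑ i', (c.1 i' : ℝ) * z (Fin.castAdd k i') + (c.2 : ℝ)) (lo i) < z (Fin.natAdd (b + 1) i) ∧ z (Fin.natAdd (b + 1) i) < Sum.elim (fun j => z (Fin.natAdd (b + 1) j)) (fun c => ∑ i', (c.1 i' : ℝ) * z (Fin.castAdd k i') + (c.2 : ℝ)) (hi i)} ∧ EqOn s.integrand (fun z => MvPolynomial.aeval (fun i => z (Fin.castAdd k (Fin.castSucc i))) p / (∏ j, (∑ i, ((L j).1 i : ℝ) * z (Fin.castAdd k (Fin.castSucc i)) + ((L j).2 : ℝ)) ^ e j) * ((z (Fin.castAdd k (Fin.last b)) - (∑ i, (ℓ₁.1 i : ℝ) * z (Fin.castAdd k (Fin.castSucc i)) + (ℓ₁.2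 : ℝ))) ^ n₁ / (z (Fin.castAdd k (Fin.last b)) - (∑ i, (ℓ₂.1 i : ℝ) * z (Fin.castAdd k (Fin.castSucc i)) + (ℓ₂.2 : ℝ))) ^ n₂) * ∏ i, (a i).elim 1 (fun c => 1 / (z (Fin.natAdd (b + 1) i) - (∑ i', (c.1 i' : ℝ) * z (Fin.castAdd k i') + (c.2 : ℝ))))) s.domain ∧ w = KZ.of s}) (hGG : ∀ b σ k, GG b σ k = {w : KZ.FormalRep | ∃ (m m' n₁ n₂ : ℕ) (s : KZ.IntegralRep (b + 1 + k)) (M : Fin m' → (Fin (b + 1) → ℚ) × ℚ) (L : Fin m → (Fin b → ℚ) × ℚ) (e : Fin m → ℕ) (p : MvPolynomial (Fin b) ℚ) (ℓ₁ ℓ₂ : (Fin b → ℚ) × ℚ) (a : Fin k → Option ((Fin (b + 1) → ℚ) × ℚ)) (lo hi : Fin k → Fin k ⊕ ((Fin (b + 1) → ℚ) × ℚ)), (n₁ = 0 ∨ n₂ = 0) ∧ (σ = 2 → (∀ i c, a i = some c → c.1 (Fin.last b) = 0) ∧ (∀ i c, (lo i = Sum.inr c ∨ hi i = Sum.inr c)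 → (c.1 (Fin.last b) = 0 ∨ c = (Pi.single (Fin.last b) 1, 0)))) ∧ Bornology.IsBounded s.domain ∧ s.domain = {z | (∀ j, 0 < ∑ i, ((M j).1 i : ℝ) * z (Fin.castAdd k i) + ((M j).2 : ℝ)) ∧ ∀ i, Sum.elim (fun j => z (Fin.natAdd (b + 1) j)) (fun c => ∑ i', (c.1 i' : ℝ) * z (Fin.castAdd k i') + (c.2 : ℝ)) (lo i) < z (Fin.natAdd (b + 1) i) ∧ z (Fin.natAdd (b + 1) i) < Sum.elim (fun j => z (Fin.natAdd (b + 1) j)) (fun c => ∑ i', (c.1 i' : ℝ) * z (Fin.castAdd k i') + (c.2 : ℝ)) (hi i)} ∧ EqOn s.integrand (fun z => MvPolynomial.aeval (fun i => z (Fin.castAdd k (Fin.castSucc i))) p / (∏ j, (∑ i, ((L j).1 i : ℝ) * z (Fin.castAdd k (Fin.castSucc i)) + ((L j).2 : ℝ)) ^ e j) * ((z (Fin.castAdd k (Fin.last b)) - (∑ i, (ℓ₁.1 i : ℝ) * z (Fin.castAdd k (Fin.castSucc i)) + (ℓ₁.2 : ℝ))) ^ n₁ / (z (Fin.castAdd k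 (Fin.last b)) - (∑ i, (ℓ₂.1 i : ℝ) * z (Fin.castAdd k (Fin.castSucc i)) + (ℓ₂.2 : ℝ))) ^ n₂) * ∏ i, (a i).elim 1 (fun c => 1 / (z (Fin.natAdd (b + 1) i) - (∑ i', (c.1 i' : ℝ) * z (Fin.castAdd k i') + (c.2 : ℝ))))) s.domain ∧ w = KZ.of s}) (JJ : ℕ → ℕ → Set KZ.FormalRep) (JD : ℕ → Set KZ.FormalRep) (hJJ : ∀ b k, JJ b k = {w : KZ.FormalRep | ∃ (m m' : ℕ) (s : KZ.IntegralRep (b + k)) (M : Fin m' → (Fin b → ℚ) × ℚ) (L : Fin m → (Fin b → ℚ) × ℚ) (e : Fin m → ℕ) (p : MvPolynomial (Fin b) ℚ) (a : Fin k → Option ((Fin b → ℚ) × ℚ)) (lo hi : Fin k → Fin k ⊕ ((Fin b → ℚ) × ℚ)), Bornology.IsBounded s.domain ∧ s.domain = {z | (∀ j, 0 < ∑ i, ((M j).1 i : ℝ) * z (Fin.castAdd k i) + ((M j).2 : ℝ)) ∧ ∀ i, Sum.elim (fun j => z (Fin.natAdd b j)) (fun c => ∑ i', (c.1 i' : ℝ)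 * z (Fin.castAdd k i') + (c.2 : ℝ)) (lo i) < z (Fin.natAdd b i) ∧ z (Fin.natAdd b i) < Sum.elim (fun j => z (Fin.natAdd b j)) (fun c => ∑ i', (c.1 i' : ℝ) * z (Fin.castAdd k i') + (c.2 : ℝ)) (hi i)} ∧ EqOn s.integrand (fun z => MvPolynomial.aeval (fun i => z (Fin.castAdd k i)) p / (∏ j, (∑ i, ((L j).1 i : ℝ) * z (Fin.castAdd k i) + ((L j).2 : ℝ)) ^ e j) * ∏ i, (a i).elim 1 (fun c => 1 / (z (Fin.natAdd b i) - (∑ i', (c.1 i' : ℝ) * z (Fin.castAdd k i') + (c.2 : ℝ))))) s.domain ∧ w = KZ.of s}) (hJD : ∀ N, JD N = {w : KZ.FormalRep | ∃ b' k', b' + k' = N ∧ w ∈ JJ b' k'}) (ε : ℚ) (hε : 0 < ε) (HU : ∀ (m : ℕ) (L : Fin m → (Fin (0 + 1 + 1) → ℚ) × ℚ) (e : Fin m → ℕ) (ℓ₁ ℓ₂ : (Fin (0 + 1 + 1) → ℚ) × ℚ) (p : MvPolynomial (Fin (0 + 1 + 1)) ℚ) (u v : (Fin (0 + 1 + 1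 + 1) → ℚ) × ℚ), u.1 (Fin.last (0 + 1 + 1)) ≠ 0 → u.1 (Fin.last (0 + 1 + 1)) = v.1 (Fin.last (0 + 1 + 1)) → ∀ (m'' m₀' : ℕ) (s' : KZ.IntegralRep ((0 + 1 + 1) + 1 + 1)) (M' : Fin m'' → (Fin (0 + 1 + 1 + 1) → ℚ) × ℚ) (M₀' : Fin m₀' → (Fin (0 + 1 + 1) → ℚ) × ℚ) (ylo' yhi' : (Fin (0 + 1 + 1) → ℚ) × ℚ), Bornology.IsBounded s'.domain → s'.domain = SeparatePos.gDom (0 + 1 + 1) 1 m'' M' (fun _ => Sum.inr u) (fun _ => Sum.inr v) → EqOn s'.integrand (RebasePos.glit (0 + 1 + 1) 1 p L e ℓ₁ ℓ₂ 0 1 (fun _ => some 0)) s'.domain → (∀ z : Fin (0 + 1 + 1 + 1 + 1) → ℝ, (∀ j, 0 < SeparatePos.affF (0 + 1 + 1) 1 (M' j) z) → 0 < SeparatePos.affF (0 + 1 + 1) 1 u z ∧ SeparatePos.affF (0 + 1 + 1) 1 u z < SeparatePos.affF (0 + 1 + 1) 1 v z) → (∀ z : Fin (0 + 1 + 1 +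 1 + 1) → ℝ, (∀ j, 0 < SeparatePos.affF (0 + 1 + 1) 1 (M' j) z) ↔ ((∀ j, 0 < SeparatePos.affB (0 + 1 + 1) 1 (M₀' j) z) ∧ SeparatePos.affB (0 + 1 + 1) 1 ylo' z < z (Fin.castAdd 1 (Fin.last (0 + 1 + 1))) ∧ z (Fin.castAdd 1 (Fin.last (0 + 1 + 1))) < SeparatePos.affB (0 + 1 + 1) 1 yhi' z)) → (∀ z : Fin (0 + 1 + 1 + 1 + 1) → ℝ, (∀ j, 0 < SeparatePos.affB (0 + 1 + 1) 1 (M₀' j) z) → SeparatePos.affB (0 + 1 + 1) 1 ylo' z < SeparatePos.affB (0 + 1 + 1) 1 yhi' z) → (∀ z : Fin (0 + 1 + 1 + 1 + 1) → ℝ, (∀ j, 0 < SeparatePos.affB (0 + 1 + 1) 1 (M₀' j) z) → (0 < u.1 (Fin.last (0 + 1 + 1)) → SeparatePos.affB (0 + 1 + 1) 1 ℓ₂ z ≤ SeparatePos.affB (0 + 1 + 1) 1 ylo' z) ∧ (u.1 (Fin.last (0 + 1 + 1)) < 0 → SeparatePos.affB (0 + 1 + 1) 1 yhi' z ≤ SeparatePos.affB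 (0 + 1 + 1) 1 ℓ₂ z)) → (∀ z : Fin (0 + 1 + 1 + 1 + 1) → ℝ, (∀ j, 0 < SeparatePos.affB (0 + 1 + 1) 1 (M₀' j) z) → SeparatePos.affF (0 + 1 + 1) 1 v z - SeparatePos.affF (0 + 1 + 1) 1 u z < ε * (SeparatePos.affB (0 + 1 + 1) 1 yhi' z - SeparatePos.affB (0 + 1 + 1) 1 ylo' z)) → ((∃ δ : ℝ, 0 < δ ∧ ∀ z : Fin (0 + 1 + 1 + 1 + 1) → ℝ, (∀ j, 0 < SeparatePos.affB (0 + 1 + 1) 1 (M₀' j) z) → δ ≤ |SeparatePos.affB (0 + 1 + 1) 1 ylo' z - SeparatePos.affB (0 + 1 + 1) 1 ℓ₂ z| ∧ δ ≤ |SeparatePos.affB (0 + 1 + 1) 1 yhi' z - SeparatePos.affB (0 + 1 + 1) 1 ℓ₂ z|) ∧ (∃ z ∈ closure {z : Fin (0 + 1 + 1 + 1 + 1) → ℝ | ∀ j, 0 < SeparatePos.affF (0 + 1 + 1) 1 (M' j) z}, SeparatePos.affB (0 + 1 + 1) 1 ylo' z = SeparatePos.affB (0 + 1 + 1) 1 yhi'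 z ∧ SeparatePos.affF (0 + 1 + 1) 1 u z = SeparatePos.affF (0 + 1 + 1) 1 v z ∧ SeparatePos.affB (0 + 1 + 1) 1 (SeparatePos.restr (0 + 1 + 1) u) z + (u.1 (Fin.last (0 + 1 + 1)) : ℝ) * SeparatePos.affB (0 + 1 + 1) 1 ℓ₂ z = 0)) → ∃ c ∈ AddSubgroup.closure (SeparatePos.GGset (0 + 1 + 1) 2 1), KZ.of s' - c ∈ KZ.relations) (Hdthick : ∀ (m : ℕ) (L : Fin m → (Fin (0 + 1 + 1) → ℚ) × ℚ) (e : Fin m → ℕ) (ℓ₁ ℓ₂ : (Fin (0 + 1 + 1) → ℚ) × ℚ), ∀ (m' : ℕ) (s : KZ.IntegralRep (0 + 1 + 1 + 1 + 1)) (M : Fin m' → (Fin (0 + 1 + 1 + 1) → ℚ) × ℚ) (p : MvPolynomial (Fin (0 + 1 + 1)) ℚ) (u v κ : (Fin (0 + 1 + 1 + 1) → ℚ) × ℚ) (A : ℚ), Bornology.IsBounded s.domain → s.domain = SeparatePos.gDom (0 + 1 + 1) 1 m' M (fun _ => Sum.inr u) (fun _ => Sum.inr v) → EqOn s.integrand (RebasePos.glit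 (0 + 1 + 1) 1 p L e ℓ₁ ℓ₂ 0 1 (fun _ => some 0)) s.domain → κ.1 (Fin.last (0 + 1 + 1)) = 0 → u - κ = A • (v - u) → 0 < A → (∀ z : Fin (0 + 1 + 1 + 1 + 1) → ℝ, (∀ j, 0 < SeparatePos.affF (0 + 1 + 1) 1 (M j) z) → SeparatePos.affF (0 + 1 + 1) 1 κ z < 0 ∧ 0 < SeparatePos.affF (0 + 1 + 1) 1 u z ∧ SeparatePos.affF (0 + 1 + 1) 1 u z < SeparatePos.affF (0 + 1 + 1) 1 v z) → (∃ z ∈ closure {z : Fin (0 + 1 + 1 + 1 + 1) → ℝ | ∀ j, 0 < SeparatePos.affF (0 + 1 + 1) 1 (M j) z}, SeparatePos.affF (0 + 1 + 1) 1 κ z = 0 ∧ SeparatePos.affF (0 + 1 + 1) 1 u z = 0 ∧ SeparatePos.affF (0 + 1 + 1) 1 v z = 0 ∧ z (Fin.castAdd 1 (Fin.last (0 + 1 + 1))) = SeparatePos.affB (0 + 1 + 1) 1 ℓ₂ z) → ∃ c ∈ AddSubgroup.closure (SeparatePos.GGset (0 + 1 + 1) 2 1), KZ.of s - c ∈ KZ.relations)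 (Hdfar : ∀ (m : ℕ) (L : Fin m → (Fin (0 + 1 + 1) → ℚ) × ℚ) (e : Fin m → ℕ) (ℓ₁ ℓ₂ : (Fin (0 + 1 + 1) → ℚ) × ℚ), ∀ (m' : ℕ) (s : KZ.IntegralRep (0 + 1 + 1 + 1 + 1)) (M : Fin m' → (Fin (0 + 1 + 1 + 1) → ℚ) × ℚ) (p : MvPolynomial (Fin (0 + 1 + 1)) ℚ) (u v κ : (Fin (0 + 1 + 1 + 1) → ℚ) × ℚ) (A : ℚ), Bornology.IsBounded s.domain → s.domain = SeparatePos.gDom (0 + 1 + 1) 1 m' M (fun _ => Sum.inr u) (fun _ => Sum.inr v) → EqOn s.integrand (RebasePos.glit (0 + 1 + 1) 1 p L e ℓ₁ ℓ₂ 0 1 (fun _ => some 0)) s.domain → κ.1 (Fin.last (0 + 1 + 1)) = 0 → u - κ = A • (v - u) → 0 < A → (∀ z : Fin (0 + 1 + 1 + 1 + 1) → ℝ, (∀ j, 0 < SeparatePos.affF (0 + 1 + 1) 1 (M j) z) → 0 < SeparatePos.affF (0 + 1 + 1) 1 κ z ∧ SeparatePos.affF (0 + 1 + 1) 1 u z <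 SeparatePos.affF (0 + 1 + 1) 1 v z ∧ 2 * SeparatePos.affF (0 + 1 + 1) 1 κ z ≤ SeparatePos.affF (0 + 1 + 1) 1 v z) → (∃ z ∈ closure {z : Fin (0 + 1 + 1 + 1 + 1) → ℝ | ∀ j, 0 < SeparatePos.affF (0 + 1 + 1) 1 (M j) z}, SeparatePos.affF (0 + 1 + 1) 1 κ z = 0 ∧ SeparatePos.affF (0 + 1 + 1) 1 u z = 0 ∧ SeparatePos.affF (0 + 1 + 1) 1 v z = 0 ∧ z (Fin.castAdd 1 (Fin.last (0 + 1 + 1))) = SeparatePos.affB (0 + 1 + 1) 1 ℓ₂ z) → ∃ c ∈ AddSubgroup.closure (SeparatePos.GGset (0 + 1 + 1) 2 1), KZ.of s - c ∈ KZ.relations) : ∀ x ∈ GS (0 + 2) 1, ∃ c ∈ AddSubgroup.closure (GG (0 + 2) 2 1 ∪ JJ (0 + 2) 2 ∪ JD (0 + 3)), x - c ∈ KZ.relations :=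
  rebaseSimplePosOnePos_of_thinQuad' GS GG hGS hGG JJ JD hJJ hJD 0 ε hε
    (fun m L e ℓ₁ ℓ₂ p u v hu hpar m'' m₀' s' M' M₀' ylo' yhi' hbd' hdom' hint' hcell' hsec' hne' hside' hthin' hUQ =>
      hUQ.elim (HU m L e ℓ₁ ℓ₂ p u v hu hpar m'' m₀' s' M' M₀' ylo' yhi' hbd' hdom' hint' hcell' hsec' hne' hside' hthin')
        fun hQ => RebasePos.good_quadCell_two L e ℓ₁ ℓ₂ s' M' M₀' ylo' yhi' p u v hbd' hdom' hint' hu hpar hcell' hsec' hQ)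
    Hdthick Hdfar

end Summit.KontsevichZagierPeriods.ArrangementNormalForm.JanusBands
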